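import Literature.Geometry.Riemannian.SingularTimeBoundedSet
import HarnessLib

/-!
# The local curvature estimate in the proof of the canonical neighbourhood theorem
(topic `Geometry/Riemannian`; Chen–Zhu 2006, proof of Thm. 4.1, Step 1)

Second elementary step of the printed proof of the named fact
`Literature.Geometry.Riemannian.chenZhu_canonicalNeighbourhoodTheorem`
(`CanonicalNeighbourhoodTheorem.lean`; B.-L. Chen, X.-P. Zhu, J. Differential Geom. 74 (2006),
arXiv:math/0504478, Thm. 4.1, proof pp. 19–23, after Perelman 2002, Thm. 12.1). Step 0, the
selection of the adjusted base point `(x_k, t_k)` — "the conclusion of the theorem fails at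
`(x_k, t_k)`, but holds for any `(x, t) ∈ M⁴_k × [t_k - H_k Q_k⁻¹, t_k]` satisfying
`R(x, t) ≥ 2Q_k`" — is `exists_adjustedBasepoint` / `IsRicciFlow.exists_adjustedPoint` there.
This file PROVES **Step 1** (arXiv p. 20): "**Claim**: For each `(x̄, t̄)` with
`t_k - (H_k/2) Q_k⁻¹ < t̄ ≤ t_k`, we have `R_k(x, t) ≤ 4Q̄_k` whenever `t̄ - c Q̄_k⁻¹ ≤ t ≤ t̄` and
`d²_{t̄}(x, x̄) ≤ c Q̄_k⁻¹`, where `Q̄_k = Q_k + R_k(x̄, t̄)` and `c > 0` is a small universal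
constant." Printed proof: "If `R_k(x,t) ≤ 2Q_k`, there is nothing to show. If `R_k(x,t) > 2Q_k`,
consider a space time curve `γ` that goes straightly from `(x,t)` to `(x, t̄)` and goes from
`(x, t̄)` to `(x̄, t̄)` along a minimizing geodesic. If there is a point on `γ` with the scalar
curvature `2Q_k`, let `p` be the nearest such point to `(x,t)`; if not, put `p = (x̄, t̄)`. On
the segment of `γ` from `(x,t)` to `p`, the scalar curvature is not less than `2Q_k`. According
to the choice of the point `(x_k, t_k)` … `|∇(R_k^{-1/2})| ≤ 2η` and `|∂ₜ(R_k⁻¹)| ≤ 2η` on the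
segment … by choosing `c > 0` (depending only on `η`) small enough we get the desired curvature
bound by integrating the above derivative estimate along the segment."

In the vocabulary of the layer the input "canonical neighbourhood at `(x, t)`" is
`HasCanonicalNeighbourhood g cov [0,T) x t ε C₁ C₂ η` (`CanonicalNeighbourhoods.lean`), whose last
clause is the pair of gradient estimates `|∇R| < η R^{3/2}`, `|∂R/∂t| < η R²` at the points of
the neighbourhood, in particular at `(x, t)` itself; the integrations are those of
`GradientEstimateIntegration.lean` / `SingularTimeBoundedSet.lean` (`R^{-1/2}` is
`η/2`-Lipschitz in space and `R⁻¹` is `η`-Lipschitz in time above the threshold, with the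
"last exit / first entry" treatment of the threshold), minimizing geodesics being replaced, as
there, by paths of length `< r` (`exists_lt_of_riemannianEDist_lt`), which is all the argument
uses.

* `le_of_forall_Ico_le`, `exists_first_entry` — the mirror images ("nearest such point to
  `(x, t)`") of `le_of_forall_Ioc_le`, `exists_last_exit` of `GradientEstimateIntegration.lean`.
* `le_inv_sub_of_deriv_le_sq_of_le_right` — **the time integration, backward form**: if
  `|φ'| ≤ η φ²` where `φ ≥ K > 0` and `φ(b) ≤ L` (`L ≥ K`), then
  `φ(s) ≤ (L⁻¹ − η (b − s))⁻¹` for `s ≤ b` with `η (b − s) < L⁻¹` (the mirror image of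
  `le_inv_sub_of_deriv_le_sq`).
* `le_of_gradient_estimate_max_of_riemEDist_lt` — the distance form of the threshold-free
  spatial estimate `le_of_gradient_estimate_path_max`.
* `IsRicciFlow.scalarCurvature_le_four_mul_of_gradient_estimates` — **Step 1 for a Ricci flow of
  Riemannian metrics on `[0, T)`** (any dimension, any manifold without boundary), from the two
  gradient estimates at the points of a time slab `M × [a, b]` where `R ≥ 2Q`, with the explicit
  admissible range `0 < c`, `32 η c ≤ 1`, `32 η² c ≤ 1` for the universal constant (then
  `R(·, t̄) ≤ (32/9) Q̄` on the ball, and `R(x, ·) ≤ 4Q̄` backward in time);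
  `IsRicciFlow.scalarCurvature_le_four_mul_of_gradient_estimates_slab` — the same over the slab
  `[t₁ − H Q⁻¹, t₁]` for `t̄ ∈ (t₁ − (H/2) Q⁻¹, t₁]`, `H ≥ 2c`, literally as printed.
* `IsRicciFlow.scalarCurvature_le_four_mul_of_hasCanonicalNeighbourhood` — **Step 1 as used on
  p. 20**: in dimension `4`, if every `(x, t)` of the slab `[t₁ − H Q⁻¹, t₁]` with `R(x, t) ≥ 2Q`
  has a canonical neighbourhood with constants `ε, C₁, C₂, η` (the outcome of Step 0), the Claim
  holds.

Everything here is proved; there are no definitions and no named facts. The sign hypothesis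
`R(x̄, t̄) ≥ 0` (so that `Q̄ ≥ Q`) is automatic in the printed setting (positive isotropic
curvature).

## References

* B.-L. Chen, X.-P. Zhu, *Ricci flow with surgery on four-manifolds with positive isotropic
  curvature*, J. Differential Geom. 74 (2006) 177–264 (arXiv:math/0504478): Thm. 4.1 (p. 19),
  proof, Step 1 (p. 20); Prop. 3.6 (p. 16); §5, p. 26 (canonical neighbourhood assumption).
  [ChenZhu2006]
* G. Perelman, *The entropy formula for the Ricci flow and its geometric applications*,
  arXiv:math/0211159 (2002), §12, proof of Thm. 12.1 (the same claim in dimension three).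
  [Perelman2002]
-/

noncomputable section

open Bundle Set Function Filter Manifold
open scoped Manifold ContDiff Topology ENNReal NNReal

namespace Literature.Geometry.Riemannian

open Lorentzian

universe u v w

/-! ### Two one-variable lemmas: limits from the left, first entry into a sublevel set -/

section Real

/-- If `φ` is continuous on `[a, b]`, `s₀ ∈ (a, b]` and `K ≤ φ` on `[a, s₀)`, then `K ≤ φ s₀`
(the mirror image of `le_of_forall_Ioc_le`). [folklore] -/
theorem le_of_forall_Ico_le {φ : ℝ → ℝ} {a b s₀ K : ℝ} (hφ : ContinuousOn φ (Icc a b))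
    (hs₀ : s₀ ∈ Icc a b) (has₀ : a < s₀) (h : ∀ s ∈ Ico a s₀, K ≤ φ s) : K ≤ φ s₀ := by
  have hsub : Ico a s₀ ⊆ Icc a b := fun s hs ↦ ⟨hs.1, hs.2.le.trans hs₀.2⟩
  have hcont : ContinuousWithinAt φ (Ico a s₀) s₀ := (hφ s₀ hs₀).mono hsub
  have hmem : s₀ ∈ closure (Ico a s₀) := by
    rw [closure_Ico has₀.ne]; exact ⟨has₀.le, le_rfl⟩
  haveI : (𝓝[Ico a s₀] s₀).NeBot := mem_closure_iff_nhdsWithin_neBot.1 hmem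
  exact ge_of_tendsto hcont (eventually_mem_nhdsWithin.mono h)

/-- **First entry into a closed sublevel set** ("let `p` be the nearest such point to `(x, t)`",
Chen–Zhu 2006, p. 20). For `φ` continuous on `[a, b]`, if `φ s ≤ K` for some `s ∈ [a, b]` then
there is a first such parameter `s₀`: `s₀ ∈ [a, b]`, `φ s₀ ≤ K`, and `K < φ s` for every
`s ∈ [a, s₀)` (`s₀` is the infimum of the closed set `{s ∈ [a, b] | φ s ≤ K}`); the mirror
image of `exists_last_exit`. [folklore] -/
theorem exists_first_entry {φ : ℝ → ℝ} {a b K : ℝ} (hφ : ContinuousOn φ (Icc a b))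
    (hne : ∃ s ∈ Icc a b, φ s ≤ K) :
    ∃ s₀ ∈ Icc a b, φ s₀ ≤ K ∧ ∀ s ∈ Ico a s₀, K < φ s := by
  set S : Set ℝ := Icc a b ∩ φ ⁻¹' Iic K with hS
  have hSc : IsClosed S := hφ.preimage_isClosed_of_isClosed isClosed_Icc isClosed_Iic
  have hSne : S.Nonempty := by
    obtain ⟨s, hs, hsK⟩ := hne
    exact ⟨s, hs, hsK⟩
  have hSb : BddBelow S := ⟨a, fun s hs ↦ hs.1.1⟩
  have hmem : sInf S ∈ S := hSc.csInf_mem hSne hSb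
  refine ⟨sInf S, hmem.1, hmem.2, fun s hs ↦ ?_⟩
  by_contra hle
  push Not at hle
  have : sInf S ≤ s := csInf_le hSb ⟨⟨hs.1, hs.2.le.trans hmem.1.2⟩, hle⟩
  exact absurd hs.2 (not_lt.2 this)

/-- **Backward in time: a bound at the final time gives a bound shortly before** (the time
integration in Step 1 of the proof of Chen–Zhu's Thm. 4.1, p. 20: "`|∂ₜ(R⁻¹)| ≤ 2η` on the
segment … integrating"). Let `φ` be continuous on `[a, b]` and, at every `s ∈ [a, b]` with
`φ s ≥ K` (`K > 0`), differentiable within `[a, b]` with `|φ' s| ≤ η (φ s)²` (`η ≥ 0`). If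
`φ b ≤ L` with `L ≥ K`, then `φ s ≤ (L⁻¹ − η (b − s))⁻¹` for every `s ∈ [a, b]` with
`η (b − s) < L⁻¹`. *Proof.* If `φ s > L`, up to the first parameter `s₁ > s` with `φ s₁ ≤ L`
(the nearest point with curvature `L`) one has `φ ≥ L ≥ K`, so
`φ(s)⁻¹ ≥ φ(s₁)⁻¹ − η (s₁ − s) ≥ L⁻¹ − η (b − s) > 0` by `abs_inv_sub_inv_le_of_deriv_le_sq`.
The mirror image of `le_inv_sub_of_deriv_le_sq`. [cite: ChenZhu2006, proof of Thm. 4.1, Step 1 (p. 20)] -/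
theorem le_inv_sub_of_deriv_le_sq_of_le_right {φ φ' : ℝ → ℝ} {a b K η L : ℝ}
    (hφ : ContinuousOn φ (Icc a b)) (hK : 0 < K) (hη : 0 ≤ η)
    (hder : ∀ s ∈ Icc a b, K ≤ φ s → HasDerivWithinAt φ (φ' s) (Icc a b) s ∧ |φ' s| ≤ η * φ s ^ 2)
    (hKL : K ≤ L) (hb : φ b ≤ L) {s : ℝ} (hs : s ∈ Icc a b) (hsmall : η * (b - s) < L⁻¹) :
    φ s ≤ (L⁻¹ - η * (b - s))⁻¹ := by
  have hL : 0 < L := hK.trans_le hKL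
  have hc : 0 < L⁻¹ - η * (b - s) := sub_pos.2 hsmall
  by_cases hsL : φ s ≤ L
  · refine hsL.trans ?_
    have h2 : L⁻¹ - η * (b - s) ≤ L⁻¹ := by linarith [mul_nonneg hη (sub_nonneg.2 hs.2)]
    calc L = (L⁻¹)⁻¹ := (inv_inv L).symm
      _ ≤ (L⁻¹ - η * (b - s))⁻¹ := inv_anti₀ hc h2
  push Not at hsL
  -- work on `[s, b]`: the first entry `s₁` into `{φ ≤ L}` after `s`
  have hφ' : ContinuousOn φ (Icc s b) := hφ.mono (Icc_subset_Icc_left hs.1)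
  obtain ⟨s₁, hs₁, hs₁L, hlt⟩ := exists_first_entry hφ' ⟨b, right_mem_Icc.2 hs.2, hb⟩
  have hss₁ : s < s₁ := lt_of_le_of_ne hs₁.1 (by rintro rfl; exact absurd hs₁L hsL.not_ge)
  have hLs₁ : L ≤ φ s₁ := le_of_forall_Ico_le hφ' hs₁ hss₁ fun u hu ↦ (hlt u hu).le
  have hKon : ∀ u ∈ Icc s s₁, K ≤ φ u := by
    intro u hu
    rcases hu.2.eq_or_lt with rfl | hlt'
    · exact hKL.trans hLs₁
    · exact hKL.trans (hlt u ⟨hu.1, hlt'⟩).le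
  have hsub : Icc s s₁ ⊆ Icc a b := fun u hu ↦ ⟨hs.1.trans hu.1, hu.2.trans hs₁.2⟩
  have hder' : ∀ u ∈ Icc s s₁, HasDerivWithinAt φ (φ' u) (Icc s s₁) u := fun u hu ↦
    ((hder u (hsub hu) (hKon u hu)).1).mono hsub
  have hb' : ∀ u ∈ Icc s s₁, |φ' u| ≤ η * φ u ^ 2 := fun u hu ↦ (hder u (hsub hu) (hKon u hu)).2
  have h := abs_inv_sub_inv_le_of_deriv_le_sq hss₁.le hK hder' hKon hb'
  have h1 : (φ s₁)⁻¹ - η * (s₁ - s) ≤ (φ s)⁻¹ := by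
    have := (abs_sub_le_iff.1 h).1
    linarith
  have h2 : L⁻¹ ≤ (φ s₁)⁻¹ := inv_anti₀ (hK.trans_le (hKon s₁ (right_mem_Icc.2 hss₁.le))) hs₁L
  have h3 : η * (s₁ - s) ≤ η * (b - s) := by gcongr; exact hs₁.2
  have h4 : L⁻¹ - η * (b - s) ≤ (φ s)⁻¹ := by linarith
  have hφs : 0 < φ s := hL.trans hsL
  calc φ s = ((φ s)⁻¹)⁻¹ := (inv_inv _).symm
    _ ≤ (L⁻¹ - η * (b - s))⁻¹ := inv_anti₀ hc h4

end Real

/-! ### The threshold-free spatial estimate, distance form -/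

section Space

variable {E : Type*} [NormedAddCommGroup E] [NormedSpace ℝ E] [FiniteDimensional ℝ E]
  {H : Type*} [TopologicalSpace H] {I : ModelWithCorners ℝ E H}
  {M : Type*} [TopologicalSpace M] [ChartedSpace H M] [IsManifold I ∞ M]

/-- **The spatial gradient estimate without a lower bound at the centre, distance form**: under
`|∇R| ≤ η R^{3/2}` on `{R ≥ K}` (`K > 0`, `η ≥ 0`), if `d_g(x, y) < d` and
`(η/2) d < m^{-1/2}` with `m = max K (R x)`, then `R(y) ≤ (m^{-1/2} − (η/2) d)⁻²` (take a path
of length `< d`, `exists_lt_of_riemannianEDist_lt`, and apply `le_of_gradient_estimate_path_max`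
— the minimizing geodesic of the printed argument is not needed).
[cite: ChenZhu2006, proof of Thm. 4.1, Step 1 (p. 20)] -/
theorem le_of_gradient_estimate_max_of_riemEDist_lt
    (g : PseudoRiemannianMetric I ∞ E (TangentSpace I : M → Type _)) (hg : g.IsRiemannian)
    {R : M → ℝ} (hR : ContMDiff I 𝓘(ℝ, ℝ) 1 R) {K η : ℝ} (hK : 0 < K) (hη : 0 ≤ η)
    (hgrad : ∀ z, K ≤ R z → Real.sqrt (g.gradSq R z) ≤ η * (R z * Real.sqrt (R z)))
    {x y : M} {d : ℝ} (hd : 0 ≤ d) (hxy : g.riemEDist x y < ENNReal.ofReal d)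
    (hsmall : η / 2 * d < (Real.sqrt (max K (R x)))⁻¹) :
    R y ≤ ((Real.sqrt (max K (R x)))⁻¹ - η / 2 * d)⁻¹ ^ 2 := by
  letI := g.riemannianBundle hg
  rw [PseudoRiemannianMetric.riemEDist_eq hg] at hxy
  have hxy' : riemannianEDist I x y < ENNReal.ofReal d := hxy
  obtain ⟨γ, hγx, hγy, hγs, hγl⟩ := exists_lt_of_riemannianEDist_lt hxy'
  have hγl' : g.length hg γ 0 1 ≤ ENNReal.ofReal d := hγl.le
  subst hγx hγy
  exact le_of_gradient_estimate_path_max g hg hR hK hη hgrad zero_le_one hγs hγl' hd hsmall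

end Space

/-! ### Step 1: the local curvature estimate for a Ricci flow -/

section Flow

variable {E : Type u} [NormedAddCommGroup E] [NormedSpace ℝ E] [FiniteDimensional ℝ E]
  [CompleteSpace E] {H : Type v} [TopologicalSpace H] {I : ModelWithCorners ℝ E H}
  [I.Boundaryless] {M : Type w} [TopologicalSpace M] [ChartedSpace H M] [IsManifold I ∞ M]
  {g : ℝ → PseudoRiemannianMetric I ∞ E (TangentSpace I : M → Type _)}
  {cov : ℝ → CovariantDerivative I E (TangentSpace I : M → Type _)} {T : ℝ}

/-- **Step 1 of the proof of the canonical neighbourhood theorem — the local curvature estimate**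
(Chen–Zhu 2006, proof of Thm. 4.1, p. 20; Perelman 2002, proof of Thm. 12.1). Let `(g, cov)` be
a Ricci flow of Riemannian metrics on `[0, T)` on a manifold without boundary, `η, Q > 0`, and
let `c` be a constant with `0 < c`, `32 η c ≤ 1`, `32 η² c ≤ 1` (the "small universal constant
depending only on `η`"). Suppose that at every `(x, t)` of the slab `M × [a, b]`
(`0 ≤ a`, `b < T`) with `R(x, t) ≥ 2Q` the gradient estimates `|∇R| ≤ η R^{3/2}` and
`|∂R/∂t| ≤ η R²` hold. Then for every `(x̄, t̄)`, `t̄ ∈ [a, b]`, with `R(x̄, t̄) ≥ 0`, writing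
`Q̄ = Q + R(x̄, t̄)`: if `t̄ − c Q̄⁻¹ ≥ a`, then `R(x, t) ≤ 4Q̄` whenever `t̄ − c Q̄⁻¹ ≤ t ≤ t̄`
and `d_{t̄}(x̄, x) ≤ (c Q̄⁻¹)^{1/2}`. *Proof* (as printed, the two legs of the space-time curve
in turn). At time `t̄`, along a path from `x̄` to `x` of length `< 2 (c/Q̄)^{1/2}`, after the last
point with `R = 2Q` (or from `x̄`): `R(x, t̄)^{-1/2} ≥ m^{-1/2} − η (c/Q̄)^{1/2} ≥ ¾ m^{-1/2}`,
`m = max (2Q, R(x̄, t̄)) ≤ 2Q̄` (this is `32 η² c ≤ 1`), so `R(x, t̄) ≤ (16/9) m ≤ (32/9) Q̄`;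
then backward in time at `x`, before the first time after `t` with `R = 2Q` (or up to `t̄`):
`R(x, t)⁻¹ ≥ (9/32) Q̄⁻¹ − η c Q̄⁻¹ ≥ ¼ Q̄⁻¹` (this is `32 η c ≤ 1`).
[cite: ChenZhu2006, proof of Thm. 4.1, Step 1 (p. 20)] [cite: Perelman2002, §12, Thm. 12.1] -/
theorem IsRicciFlow.scalarCurvature_le_four_mul_of_gradient_estimates
    (hflow : IsRicciFlow g cov (Ico 0 T)) (hRiem : ∀ t ∈ Ico 0 T, (g t).IsRiemannian)
    {η Q c a b : ℝ} (hη : 0 < η) (hQ : 0 < Q) (hc : 0 < c) (hc₁ : 32 * η * c ≤ 1)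
    (hc₂ : 32 * η ^ 2 * c ≤ 1) (ha : 0 ≤ a) (hbT : b < T)
    (hgrad : ∀ t ∈ Icc a b, ∀ x : M, 2 * Q ≤ (g t).scalarCurvatureWith (cov t) x →
      Real.sqrt ((g t).gradSq (fun z ↦ (g t).scalarCurvatureWith (cov t) z) x) ≤
        η * ((g t).scalarCurvatureWith (cov t) x *
          Real.sqrt ((g t).scalarCurvatureWith (cov t) x)))
    (htime : ∀ t ∈ Icc a b, ∀ x : M, 2 * Q ≤ (g t).scalarCurvatureWith (cov t) x →
      |derivWithin (fun s ↦ (g s).scalarCurvatureWith (cov s) x) (Ico 0 T) t| ≤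
        η * (g t).scalarCurvatureWith (cov t) x ^ 2)
    {xbar : M} {tbar Qbar : ℝ} (htbar : tbar ∈ Icc a b)
    (hRbar : 0 ≤ (g tbar).scalarCurvatureWith (cov tbar) xbar)
    (hQbar : Qbar = Q + (g tbar).scalarCurvatureWith (cov tbar) xbar)
    (hwin : a ≤ tbar - c / Qbar)
    {x : M} (hx : (g tbar).riemEDist xbar x ≤ ENNReal.ofReal (Real.sqrt (c / Qbar)))
    {t : ℝ} (ht : t ∈ Icc (tbar - c / Qbar) tbar) :
    (g t).scalarCurvatureWith (cov t) x ≤ 4 * Qbar := by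
  have hQQ : Q ≤ Qbar := by rw [hQbar]; linarith
  have hQbar0 : 0 < Qbar := hQ.trans_le hQQ
  have htbar0 : tbar ∈ Ico 0 T := ⟨ha.trans htbar.1, htbar.2.trans_lt hbT⟩
  have hgb : (g tbar).IsRiemannian := hRiem tbar htbar0
  have h2Q : 0 < 2 * Q := by positivity
  /- (i) the spatial leg at time `tbar`: `R(x, tbar) ≤ (32/9) Qbar` -/
  set Rf : M → ℝ := fun z ↦ (g tbar).scalarCurvatureWith (cov tbar) z with hRf
  have h1le : (1 : ℕ∞ω) ≤ ((⊤ : ℕ∞) : ℕ∞ω) := WithTop.coe_le_coe.mpr le_top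
  have hRfs : ContMDiff I 𝓘(ℝ, ℝ) 1 Rf :=
    ((hflow.isLeviCivita tbar htbar0).contMDiff_trace_ricci).of_le h1le
  have hgrad₁ : ∀ z, 2 * Q ≤ Rf z →
      Real.sqrt ((g tbar).gradSq Rf z) ≤ η * (Rf z * Real.sqrt (Rf z)) :=
    fun z hz ↦ hgrad tbar htbar z hz
  set m : ℝ := max (2 * Q) (Rf xbar) with hm
  have hm0 : 0 < m := h2Q.trans_le (le_max_left _ _)
  have hm2 : m ≤ 2 * Qbar := by
    refine max_le (by linarith) ?_
    show (g tbar).scalarCurvatureWith (cov tbar) xbar ≤ 2 * Qbar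
    rw [hQbar]; linarith
  have hsm : 0 < Real.sqrt m := Real.sqrt_pos.2 hm0
  -- the radius `ρ = (c/Qbar)^{1/2}` and a path of length `< 2ρ`
  set ρ : ℝ := Real.sqrt (c / Qbar) with hρ
  have hρ0 : 0 < ρ := Real.sqrt_pos.2 (div_pos hc hQbar0)
  have hxy : (g tbar).riemEDist xbar x < ENNReal.ofReal (2 * ρ) :=
    lt_of_le_of_lt hx ((ENNReal.ofReal_lt_ofReal_iff (by positivity)).2 (by linarith))
  -- smallness of `c` in space: `η ρ ≤ m^{-1/2} / 4`, from `32 η² c ≤ 1` and `m ≤ 2 Qbar`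
  have hsq : Real.sqrt (c / Qbar) * Real.sqrt m ≤ Real.sqrt (2 * c) := by
    rw [← Real.sqrt_mul (div_nonneg hc.le hQbar0.le)]
    apply Real.sqrt_le_sqrt
    calc c / Qbar * m ≤ c / Qbar * (2 * Qbar) := by gcongr
      _ = 2 * c := by field_simp
  have h4 : 4 * η * Real.sqrt (2 * c) ≤ 1 := by
    have h0 : 0 ≤ 4 * η * Real.sqrt (2 * c) := by positivity
    have hsq2 : (4 * η * Real.sqrt (2 * c)) ^ 2 ≤ 1 := by
      rw [mul_pow, Real.sq_sqrt (by positivity)]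
      nlinarith [hc₂]
    nlinarith [hsq2, h0]
  have hprod : η * ρ * Real.sqrt m ≤ 1 / 4 := by
    calc η * ρ * Real.sqrt m = η * (Real.sqrt (c / Qbar) * Real.sqrt m) := by rw [hρ]; ring
      _ ≤ η * Real.sqrt (2 * c) := by gcongr
      _ ≤ 1 / 4 := by linarith [h4]
  have hkey : η * ρ ≤ (Real.sqrt m)⁻¹ / 4 := by
    have e : η * ρ = η * ρ * Real.sqrt m / Real.sqrt m := by field_simp
    rw [e]
    calc η * ρ * Real.sqrt m / Real.sqrt m ≤ (1 / 4) / Real.sqrt m := by gcongr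
      _ = (Real.sqrt m)⁻¹ / 4 := by ring
  have hspace : Rf x ≤ 32 / 9 * Qbar := by
    have hipos : 0 < (Real.sqrt m)⁻¹ := inv_pos.2 hsm
    have hsmall : η / 2 * (2 * ρ) < (Real.sqrt m)⁻¹ := by nlinarith [hkey, hipos]
    have h := le_of_gradient_estimate_max_of_riemEDist_lt (g tbar) hgb hRfs h2Q hη.le hgrad₁
      (by positivity : (0 : ℝ) ≤ 2 * ρ) hxy hsmall
    have hlow : 3 / 4 * (Real.sqrt m)⁻¹ ≤ (Real.sqrt m)⁻¹ - η / 2 * (2 * ρ) := by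
      nlinarith [hkey]
    have hpos : 0 < 3 / 4 * (Real.sqrt m)⁻¹ := by positivity
    calc Rf x ≤ ((Real.sqrt m)⁻¹ - η / 2 * (2 * ρ))⁻¹ ^ 2 := h
      _ ≤ (3 / 4 * (Real.sqrt m)⁻¹)⁻¹ ^ 2 :=
          pow_le_pow_left₀ (inv_nonneg.2 (hpos.le.trans hlow)) (inv_anti₀ hpos hlow) 2
      _ = 16 / 9 * m := by
          rw [mul_inv, inv_inv, mul_pow, Real.sq_sqrt hm0.le]; norm_num
      _ ≤ 32 / 9 * Qbar := by linarith [hm2]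
  /- (ii) the temporal leg at the point `x`, backward from `tbar` to `t` -/
  have htI : Icc t tbar ⊆ Icc a b := fun s hs ↦ ⟨hwin.trans (ht.1.trans hs.1), hs.2.trans htbar.2⟩
  have htI0 : Icc t tbar ⊆ Ico 0 T := fun s hs ↦ ⟨ha.trans (htI hs).1, (htI hs).2.trans_lt hbT⟩
  set φ : ℝ → ℝ := fun s ↦ (g s).scalarCurvatureWith (cov s) x with hφdef
  have hcont : ContinuousOn φ (Icc t tbar) :=
    (hflow.continuousOn_scalarCurvatureWith (uniqueDiffOn_Ico 0 T) x).mono htI0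
  have hder' : ∀ u ∈ Icc t tbar, 2 * Q ≤ φ u →
      HasDerivWithinAt φ (derivWithin φ (Ico 0 T) u) (Icc t tbar) u ∧
        |derivWithin φ (Ico 0 T) u| ≤ η * φ u ^ 2 := fun u hu hKu ↦
    ⟨(hflow.hasDerivWithinAt_scalarCurvatureWith_Ico (htI0 hu) x).mono htI0,
      htime u (htI hu) x hKu⟩
  have hL : 2 * Q ≤ 32 / 9 * Qbar := by linarith
  have hφb : φ tbar ≤ 32 / 9 * Qbar := hspace
  -- smallness of `c` in time: `η (tbar - t) ≤ η c / Qbar ≤ (32 Qbar)⁻¹`, from `32 η c ≤ 1`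
  have hηt : η * (tbar - t) ≤ (32 * Qbar)⁻¹ := by
    have h1 : tbar - t ≤ c / Qbar := by linarith [ht.1]
    have h2 : η * c ≤ 1 / 32 := by nlinarith [hc₁]
    calc η * (tbar - t) ≤ η * (c / Qbar) := by gcongr
      _ = η * c / Qbar := (mul_div_assoc η c Qbar).symm
      _ ≤ (1 / 32) / Qbar := by gcongr
      _ = (32 * Qbar)⁻¹ := by ring
  have hsmallt : η * (tbar - t) < (32 / 9 * Qbar)⁻¹ := by
    refine hηt.trans_lt ?_
    rw [inv_lt_inv₀ (by positivity) (by positivity)]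
    linarith
  have h := le_inv_sub_of_deriv_le_sq_of_le_right hcont h2Q hη.le hder' hL hφb
    (left_mem_Icc.2 ht.2) hsmallt
  refine h.trans ?_
  have hlow : (4 * Qbar)⁻¹ ≤ (32 / 9 * Qbar)⁻¹ - η * (tbar - t) := by
    have e1 : (32 / 9 * Qbar)⁻¹ = 9 * (32 * Qbar)⁻¹ := by ring
    have e2 : (4 * Qbar)⁻¹ = 8 * (32 * Qbar)⁻¹ := by ring
    rw [e1, e2]
    linarith
  calc ((32 / 9 * Qbar)⁻¹ - η * (tbar - t))⁻¹ ≤ ((4 * Qbar)⁻¹)⁻¹ :=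
        inv_anti₀ (by positivity) hlow
    _ = 4 * Qbar := inv_inv _

/-- **Step 1, slab form as printed** (Chen–Zhu 2006, p. 20: for `(x̄, t̄)` with
`t_k − (H_k/2) Q_k⁻¹ < t̄ ≤ t_k`, when the gradient estimates hold at the points of
`M × [t_k − H_k Q_k⁻¹, t_k]` with `R ≥ 2Q_k`): hypotheses as in
`IsRicciFlow.scalarCurvature_le_four_mul_of_gradient_estimates` on the slab `[t₁ − H Q⁻¹, t₁]`
(`0 ≤ t₁ − H Q⁻¹`, `t₁ < T`), with `H ≥ 2c` (in print `H_k → +∞`); then for `t̄ ∈ (t₁ − (H/2) Q⁻¹, t₁]`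
and `R(x̄, t̄) ≥ 0`, `Q̄ = Q + R(x̄, t̄)`: `R(x, t) ≤ 4Q̄` whenever `t̄ − c Q̄⁻¹ ≤ t ≤ t̄` and
`d_{t̄}(x̄, x) ≤ (c Q̄⁻¹)^{1/2}` (the backward window stays in the slab since `c Q̄⁻¹ ≤ (H/2) Q⁻¹`).
[cite: ChenZhu2006, proof of Thm. 4.1, Step 1 (p. 20)] -/
theorem IsRicciFlow.scalarCurvature_le_four_mul_of_gradient_estimates_slab
    (hflow : IsRicciFlow g cov (Ico 0 T)) (hRiem : ∀ t ∈ Ico 0 T, (g t).IsRiemannian)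
    {η Q c H t₁ : ℝ} (hη : 0 < η) (hQ : 0 < Q) (hc : 0 < c) (hc₁ : 32 * η * c ≤ 1)
    (hc₂ : 32 * η ^ 2 * c ≤ 1) (hcH : 2 * c ≤ H) (ht₁0 : 0 ≤ t₁ - H / Q) (ht₁T : t₁ < T)
    (hgrad : ∀ t ∈ Icc (t₁ - H / Q) t₁, ∀ x : M, 2 * Q ≤ (g t).scalarCurvatureWith (cov t) x →
      Real.sqrt ((g t).gradSq (fun z ↦ (g t).scalarCurvatureWith (cov t) z) x) ≤
        η * ((g t).scalarCurvatureWith (cov t) x *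
          Real.sqrt ((g t).scalarCurvatureWith (cov t) x)))
    (htime : ∀ t ∈ Icc (t₁ - H / Q) t₁, ∀ x : M, 2 * Q ≤ (g t).scalarCurvatureWith (cov t) x →
      |derivWithin (fun s ↦ (g s).scalarCurvatureWith (cov s) x) (Ico 0 T) t| ≤
        η * (g t).scalarCurvatureWith (cov t) x ^ 2)
    {xbar : M} {tbar Qbar : ℝ} (htbar : tbar ∈ Ioc (t₁ - H / (2 * Q)) t₁)
    (hRbar : 0 ≤ (g tbar).scalarCurvatureWith (cov tbar) xbar)
    (hQbar : Qbar = Q + (g tbar).scalarCurvatureWith (cov tbar) xbar)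
    {x : M} (hx : (g tbar).riemEDist xbar x ≤ ENNReal.ofReal (Real.sqrt (c / Qbar)))
    {t : ℝ} (ht : t ∈ Icc (tbar - c / Qbar) tbar) :
    (g t).scalarCurvatureWith (cov t) x ≤ 4 * Qbar := by
  have hQQ : Q ≤ Qbar := by rw [hQbar]; linarith
  have hH : 0 < H := by linarith
  -- `c / Qbar ≤ c / Q ≤ H / (2 Q) = (H / Q) / 2`
  have h1 : c / Qbar ≤ c / Q := div_le_div_of_nonneg_left hc.le hQ hQQ
  have h2 : c / Q ≤ H / (2 * Q) := by
    rw [div_le_div_iff₀ hQ (by positivity)]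
    nlinarith
  have h4 : H / (2 * Q) = H / Q / 2 := by rw [div_div, mul_comm]
  have hHQ : 0 ≤ H / Q := by positivity
  have htbar' : tbar ∈ Icc (t₁ - H / Q) t₁ := ⟨by linarith [htbar.1], htbar.2⟩
  have hwin : t₁ - H / Q ≤ tbar - c / Qbar := by linarith [htbar.1, h1.trans h2]
  exact hflow.scalarCurvature_le_four_mul_of_gradient_estimates hRiem hη hQ hc hc₁ hc₂ ht₁0 ht₁T
    hgrad htime htbar' hRbar hQbar hwin hx ht

end Flow

/-! ### Step 1 from canonical neighbourhoods (dimension four, as used on p. 20) -/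

section Canonical

variable {M : Type*} [TopologicalSpace M] [ChartedSpace (EuclideanSpace ℝ (Fin 4)) M]
  [IsManifold (𝓡 4) ∞ M] [T3Space M] [MeasurableSpace M] [BorelSpace M]
  {g : ℝ → PseudoRiemannianMetric (𝓡 4) ∞ (EuclideanSpace ℝ (Fin 4))
    (TangentSpace (𝓡 4) : M → Type _)}
  {cov : ℝ → CovariantDerivative (𝓡 4) (EuclideanSpace ℝ (Fin 4))
    (TangentSpace (𝓡 4) : M → Type _)} {T : ℝ}

/-- **Step 1 of the proof of Theorem 4.1, from the outcome of Step 0** (Chen–Zhu 2006, p. 20: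
"According to the choice of the point `(x_k, t_k)`, the solution along the segment is `ε`-close
to that of some ancient `κ`-solutions … It follows from Proposition 3.6 (ii) that
`|∇(R_k^{-1/2})| ≤ 2η` and `|∂ₜ(R_k⁻¹)| ≤ 2η` on the segment"; in the layer's `C⁰` vocabulary the
canonical neighbourhood `HasCanonicalNeighbourhood g cov [0,T) x t ε C₁ C₂ η` of a point carries
the gradient estimates `|∇R| < η R^{3/2}`, `|∂R/∂t| < η R²` at that point). For a Ricci flow of
Riemannian metrics on `[0, T)` on a 4-manifold without boundary: if every `(x, t)` of the slab
`M × [t₁ − H Q⁻¹, t₁]` (`0 ≤ t₁ − H Q⁻¹`, `t₁ < T`, `Q > 0`) with `R(x, t) ≥ 2Q` has a canonical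
neighbourhood with constants `ε, C₁, C₂, η` (`η > 0`), and `0 < c`, `32 η c ≤ 1`, `32 η² c ≤ 1`,
`2c ≤ H`, then for every `(x̄, t̄)` with `t̄ ∈ (t₁ − (H/2) Q⁻¹, t₁]` and `R(x̄, t̄) ≥ 0`, writing
`Q̄ = Q + R(x̄, t̄)`: `R(x, t) ≤ 4Q̄` whenever `t̄ − c Q̄⁻¹ ≤ t ≤ t̄` and
`d_{t̄}(x̄, x) ≤ (c Q̄⁻¹)^{1/2}`. [cite: ChenZhu2006, proof of Thm. 4.1, Step 1 (p. 20)] -/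
theorem IsRicciFlow.scalarCurvature_le_four_mul_of_hasCanonicalNeighbourhood
    (hflow : IsRicciFlow g cov (Ico 0 T)) (hRiem : ∀ t ∈ Ico 0 T, (g t).IsRiemannian)
    {ε C₁ C₂ η Q c H t₁ : ℝ} (hη : 0 < η) (hQ : 0 < Q) (hc : 0 < c) (hc₁ : 32 * η * c ≤ 1)
    (hc₂ : 32 * η ^ 2 * c ≤ 1) (hcH : 2 * c ≤ H) (ht₁0 : 0 ≤ t₁ - H / Q) (ht₁T : t₁ < T)
    (hcn : ∀ t ∈ Icc (t₁ - H / Q) t₁, ∀ x : M, 2 * Q ≤ (g t).scalarCurvatureWith (cov t) x →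
      HasCanonicalNeighbourhood g cov (Ico 0 T) x t ε C₁ C₂ η)
    {xbar : M} {tbar Qbar : ℝ} (htbar : tbar ∈ Ioc (t₁ - H / (2 * Q)) t₁)
    (hRbar : 0 ≤ (g tbar).scalarCurvatureWith (cov tbar) xbar)
    (hQbar : Qbar = Q + (g tbar).scalarCurvatureWith (cov tbar) xbar)
    {x : M} (hx : (g tbar).riemEDist xbar x ≤ ENNReal.ofReal (Real.sqrt (c / Qbar)))
    {t : ℝ} (ht : t ∈ Icc (tbar - c / Qbar) tbar) :
    (g t).scalarCurvatureWith (cov t) x ≤ 4 * Qbar := by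
  -- the gradient estimates at the points of the slab with `R ≥ 2Q`, read off from their
  -- canonical neighbourhoods (which contain the point itself)
  have key : ∀ s ∈ Icc (t₁ - H / Q) t₁, ∀ y : M, 2 * Q ≤ (g s).scalarCurvatureWith (cov s) y →
      Real.sqrt ((g s).gradSq (fun z ↦ (g s).scalarCurvatureWith (cov s) z) y) <
          η * ((g s).scalarCurvatureWith (cov s) y *
            Real.sqrt ((g s).scalarCurvatureWith (cov s) y)) ∧
        |derivWithin (fun u ↦ (g u).scalarCurvatureWith (cov u) y) (Ico 0 T) s| <
          η * (g s).scalarCurvatureWith (cov s) y ^ 2 := by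
    intro s hs y hy
    obtain ⟨B, σ, hσ, -, hball, -, -, -, hgradB⟩ := hcn s hs y hy
    have hyB : y ∈ (B : Set M) :=
      hball (PseudoRiemannianMetric.mem_ball_self y (ENNReal.ofReal_pos.2 hσ))
    exact hgradB y hyB
  exact hflow.scalarCurvature_le_four_mul_of_gradient_estimates_slab hRiem hη hQ hc hc₁ hc₂ hcH
    ht₁0 ht₁T (fun s hs y hy ↦ (key s hs y hy).1.le) (fun s hs y hy ↦ (key s hs y hy).2.le)
    htbar hRbar hQbar hx ht

end Canonical

end Literature.Geometry.Riemannian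

end
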